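import Summits.ResolutionOfSingularities.ResolutionOfSingularities.Theorems.EquisingularLiftEquisingularLiftNatDeltaConeLift
import Literature.AlgebraicGeometry.Resolution.Dehomogenization
import Literature.NumberTheory.Transcendental.RoySmallValueFactors
import Mathlib.RingTheory.Radical.Basic
import Mathlib.Algebra.Squarefree.Basic
import Mathlib.Algebra.MvPolynomial.NoZeroDivisors
import Mathlib.RingTheory.Polynomial.UniqueFactorization
import Mathlib.RingTheory.Nilpotent.Lemmas
import HarnessLib

/-!
# [OURS · L1 W4.5(b) · EL♮] T-TCONE, part 3: the SQUARE-FREE PART of the initial form — existence, and square-freeness of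
# its dehomogenisations — crux `EquisingularLiftNat` = stmt-ResolutionOfSingularities-20038

HONEST FRAMING. OURS (cell res-hironaka, crux chain w45b, slot W4.5(b)); NOT a statement of any manuscript; AI-written, weaker than
expert review. Helper `--supports stmt-ResolutionOfSingularities-20038 --as helper`; it closes nothing. Object = the input `g :=`
«square-free part of `in_d w`» of res-L1-w45b-lead-2's T-TCONE (STATUS 2026-08-27T08:06:58Z), in the exact shape consumed by
part 2 (`…NatTangentConeFibreReduced`, hypotheses (R1) `φ ∈ √(ḡ)`, `ḡ ∈ √(φ)` and (R2) `(ḡ(T_j := 1))` radical) and by res-type-032's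
T-ΔLIFT PLANE (`exists_isHomogeneous_lift_deltaRegular_plane`, hypothesis `∀ i, Squarefree (dehomogenize i g)`). Pure commutative
algebra; no scheme appears in this file.

CONTENT.
* `exists_isHomogeneous_dehomogenize_eq'` — HOMOGENISATION (existence): every `q ∈ R[T_l : l ≠ i]` with `deg q ≤ e` is the
  dehomogenisation `Q(T_i := 1)` of a form `Q ∈ R[T]` of degree `e` (pad each monomial with the missing power of `T_i`).
* `eq_of_isHomogeneous_of_dehomogenize_eq` — dehomogenisation is injective on forms of a fixed degree (tree
  `dehomogenize_ne_zero_of_isHomogeneous`).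
* `squarefree_dehomogenize_of_isHomogeneous` — **a square-free FORM has square-free dehomogenisations** (`k` a domain): if
  `x² m = g(T_i := 1)`, homogenise `x, m` minimally to `X, M`; degrees add (`totalDegree_mul_of_isDomain`), so
  `T_i^s X² M` and `g` are forms of the same degree `d` with the same dehomogenisation, hence equal; `X² ∣ g` forces `X`, hence
  `x = X(T_i := 1)`, to be a unit. `isRadical_span_dehomogenize_of_squarefree` — hence `(g(T_i := 1))` is a radical ideal (`k` a field).
* `exists_squarefree_initialForm` — over a field: every non-zero form `φ` has a SQUARE-FREE FORM `g` (its radical in the UFD `k[T]`,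
  Mathlib `UniqueFactorizationMonoid.radical`; a form by «divisors of forms are forms», tree `Roy2013.isHomogeneous_of_dvd`) with
  `φ ∈ √(g)`, `g ∈ √(φ)`, all `g(T_i := 1)` square-free and generating radical ideals.
* `exists_isHomogeneous_squarefree_reduction` — the same read over `R ⧸ (c)` for a maximal `(c)` and LIFTED to a form `G ∈ R[T]`
  (res-type-032's `exists_isHomogeneous_map_eq_of_surjective`): exactly the data `(G, (R1), (R2))` of part 2's
  `stalkIdeal_vanishingIdeal_carrierTrace_of_presentation` / `vanishingIdeal_carrierTrace_eq_strictTransformIdeal_sup_comap`.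

References: folklore (UFD `k[T]`); The Stacks Project, Tag 0BIQ (context only) — through Mathlib and the cited tree files.
-/

set_option linter.dupNamespace false -- mandated namespace `Summit.<Summit>.<Problem>` of this single-conjunct summit

noncomputable section

open MvPolynomial Literature.AlgebraicGeometry.Resolution

namespace Summit.ResolutionOfSingularities.ResolutionOfSingularities.Cruxes.EquisingularLiftNat.Sections

universe u

/-! ## Homogenisation along `dehomogenize` -/

section Homogenize

variable {R : Type u} [CommRing R] {σ : Type*} [DecidableEq σ] (i : σ)

/-- `T_i ↦ 1` under dehomogenisation. [folklore] -/
theorem dehomogenize_X_self : dehomogenize (R := R) i (X i) = 1 := by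
  rw [MvPolynomial.aeval_X, killVar_self]

/-- **Homogenisation (existence).** Every `q ∈ R[T_l : l ≠ i]` of total degree `≤ e` is `Q(T_i := 1)` for a form `Q ∈ R[T_σ]` of
degree `e`: pad each monomial `T̂^β` of `q` to `T̂^β · T_i^{e - |β|}`. [folklore] -/
theorem exists_isHomogeneous_dehomogenize_eq' (q : MvPolynomial {l : σ // l ≠ i} R) {e : ℕ} (he : q.totalDegree ≤ e) :
    ∃ Q : MvPolynomial σ R, Q.IsHomogeneous e ∧ dehomogenize i Q = q := by
  classical
  -- the padded exponent of `β`
  let lift : ({l : σ // l ≠ i} →₀ ℕ) → (σ →₀ ℕ) := fun β =>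
    Finsupp.mapDomain Subtype.val β + Finsupp.single i (e - Finsupp.degree β)
  have hres : ∀ β, (lift β).subtypeDomain (· ≠ i) = β := by
    intro β
    ext l
    rw [Finsupp.subtypeDomain_apply, Finsupp.add_apply, Finsupp.mapDomain_apply Subtype.val_injective,
      Finsupp.single_apply, if_neg (fun h => l.2 h.symm), add_zero]
  have hdegmap : ∀ β : {l : σ // l ≠ i} →₀ ℕ, Finsupp.degree (Finsupp.mapDomain Subtype.val β) = Finsupp.degree β :=
    fun β => Finsupp.degree_mapDomain Subtype.val β
  have hdeg : ∀ β ∈ q.support, Finsupp.degree (lift β) = e := by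
    intro β hβ
    have hβe : Finsupp.degree β ≤ e := (MvPolynomial.le_totalDegree hβ).trans he
    rw [map_add, hdegmap, Finsupp.degree_single]
    omega
  refine ⟨∑ β ∈ q.support, monomial (lift β) (q.coeff β), ?_, ?_⟩
  · exact IsHomogeneous.sum _ _ _ fun β hβ => isHomogeneous_monomial _ (hdeg β hβ)
  · rw [map_sum]
    simp_rw [dehomogenize_monomial, hres]
    exact q.support_sum_monomial_coeff

/-- **Dehomogenisation is injective on forms of a fixed degree.** [folklore] -/
theorem eq_of_isHomogeneous_of_dehomogenize_eq {F G : MvPolynomial σ R} {n : ℕ} (hF : F.IsHomogeneous n)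
    (hG : G.IsHomogeneous n) (h : dehomogenize i F = dehomogenize i G) : F = G := by
  by_contra hne
  have h0 : dehomogenize i (F - G) ≠ 0 := dehomogenize_ne_zero_of_isHomogeneous i (hF.sub hG) (sub_ne_zero.mpr hne)
  rw [map_sub, h, sub_self] at h0
  exact h0 rfl

end Homogenize

/-! ## Square-free forms have square-free dehomogenisations -/

section Squarefree

variable {k : Type u} [CommRing k] [IsDomain k] {σ : Type*} [DecidableEq σ] (i : σ)

/-- **A square-free FORM has square-free dehomogenisations** (`k` a domain). If `x · x ∣ g(T_i := 1)`, homogenise `x` and the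
cofactor minimally; total degrees add over a domain, so after padding with a power of `T_i` one gets a form of degree `deg g` with
the same dehomogenisation as `g`, hence equal to `g` — and `X · X ∣ g` makes the homogenisation `X` of `x`, hence `x`, a unit.
[folklore] -/
theorem squarefree_dehomogenize_of_isHomogeneous {g : MvPolynomial σ k} {d : ℕ} (hg : g.IsHomogeneous d)
    (hsq : Squarefree g) : Squarefree (dehomogenize i g) := by
  classical
  intro x hx
  obtain ⟨m, hm⟩ := hx
  have hg0 : g ≠ 0 := hsq.ne_zero
  have hgi0 : dehomogenize i g ≠ 0 := dehomogenize_ne_zero_of_isHomogeneous i hg hg0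
  have hx0 : x ≠ 0 := fun h => hgi0 (by rw [hm, h, zero_mul, zero_mul])
  have hm0 : m ≠ 0 := fun h => hgi0 (by rw [hm, h, mul_zero])
  -- minimal homogenisations of `x` and `m`
  obtain ⟨P, hP, hPx⟩ := exists_isHomogeneous_dehomogenize_eq' i x (e := x.totalDegree) le_rfl
  obtain ⟨M, hM, hMm⟩ := exists_isHomogeneous_dehomogenize_eq' i m (e := m.totalDegree) le_rfl
  -- degrees: `2 deg x + deg m = deg g(T_i := 1) ≤ d`
  have hdeg : x.totalDegree + x.totalDegree + m.totalDegree ≤ d := by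
    have h1 : (dehomogenize i g).totalDegree = x.totalDegree + x.totalDegree + m.totalDegree := by
      rw [hm, totalDegree_mul_of_isDomain (mul_ne_zero hx0 hx0) hm0, totalDegree_mul_of_isDomain hx0 hx0]
    have h2 := totalDegree_dehomogenize_le i g
    rw [hg.totalDegree hg0, h1] at h2
    exact h2
  -- the padded product is a form of degree `d` with the same dehomogenisation as `g`, hence equals `g`
  set s := d - (x.totalDegree + x.totalDegree + m.totalDegree) with hs
  have hF : (X i ^ s * (P * P * M)).IsHomogeneous d := by
    have h := ((isHomogeneous_X k i).pow s).mul ((hP.mul hP).mul hM)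
    rwa [show 1 * s + (x.totalDegree + x.totalDegree + m.totalDegree) = d by omega] at h
  have hFg : dehomogenize i (X i ^ s * (P * P * M)) = dehomogenize i g := by
    rw [map_mul, map_pow, dehomogenize_X_self, one_pow, one_mul, map_mul, map_mul, hPx, hMm, hm]
  have hEq := eq_of_isHomogeneous_of_dehomogenize_eq i hF hg hFg
  have hdvd : P * P ∣ g := ⟨X i ^ s * M, by rw [← hEq]; ring⟩
  have hu : IsUnit P := hsq P hdvd
  rw [← hPx]
  exact hu.map (dehomogenize i)

end Squarefree

/-! ## Over a field: the square-free part of a form -/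

section Field

variable {k : Type u} [Field k] {σ : Type*} [DecidableEq σ]

/-- Over a field, `(g(T_i := 1))` is a RADICAL ideal for every square-free form `g`. [folklore] -/
theorem isRadical_span_dehomogenize_of_squarefree (i : σ) {g : MvPolynomial σ k} {d : ℕ} (hg : g.IsHomogeneous d)
    (hsq : Squarefree g) : (Ideal.span {dehomogenize i g}).IsRadical :=
  (isRadical_iff_span_singleton).mp (squarefree_dehomogenize_of_isHomogeneous i hg hsq).isRadical

omit [DecidableEq σ] in
/-- **The square-free part of a form.** Over a field, every non-zero form `φ` admits a square-free form `g` (the radical of `φ` in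
the UFD `k[T]`) with `g ∣ φ` and `φ ∣ gⁿ` for some `n`. [folklore] -/
theorem exists_squarefree_isHomogeneous_dvd {φ : MvPolynomial σ k} {d : ℕ} (hφ : φ.IsHomogeneous d) (hφ0 : φ ≠ 0) :
    ∃ g : MvPolynomial σ k, g.IsHomogeneous g.totalDegree ∧ g ≠ 0 ∧ Squarefree g ∧ g ∣ φ ∧ ∃ n : ℕ, φ ∣ g ^ n := by
  classical
  letI : NormalizationMonoid (MvPolynomial σ k) := UniqueFactorizationMonoid.strongNormalizationMonoid.toNormalizationMonoid
  refine ⟨UniqueFactorizationMonoid.radical φ, ?_, ?_, UniqueFactorizationMonoid.squarefree_radical,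
    UniqueFactorizationMonoid.radical_dvd_self, UniqueFactorizationMonoid.exists_dvd_radical_self_pow hφ0⟩
  · exact Literature.NumberTheory.Transcendental.Roy2013.isHomogeneous_of_dvd hφ hφ0
      UniqueFactorizationMonoid.radical_dvd_self
  · exact UniqueFactorizationMonoid.squarefree_radical.ne_zero

/-- **T-TCONE's `g`, field form.** Over a field `k`, every non-zero form `φ ∈ k[T_σ]` (the initial form `in_d w`) admits a non-zero
form `g` with (R1) `φ ∈ √(g)`, `g ∈ √(φ)` (same zero set `V₊(g) = V₊(φ)`), `g` square-free, every dehomogenisation `g(T_i := 1)`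
square-free (res-type-032's T-ΔLIFT PLANE hypothesis) and (R2) generating a radical ideal (part 2's hypothesis). [folklore] -/
theorem exists_squarefree_initialForm {φ : MvPolynomial σ k} {d : ℕ} (hφ : φ.IsHomogeneous d) (hφ0 : φ ≠ 0) :
    ∃ g : MvPolynomial σ k, g.IsHomogeneous g.totalDegree ∧ g ≠ 0 ∧ Squarefree g ∧
      φ ∈ (Ideal.span {g}).radical ∧ g ∈ (Ideal.span {φ}).radical ∧
      (∀ i : σ, Squarefree (dehomogenize i g)) ∧ ∀ i : σ, (Ideal.span {dehomogenize i g}).IsRadical := by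
  obtain ⟨g, hg, hg0, hsq, hgφ, n, hφg⟩ := exists_squarefree_isHomogeneous_dvd hφ hφ0
  refine ⟨g, hg, hg0, hsq, ?_, ⟨n, Ideal.mem_span_singleton.mpr hφg⟩,
    fun i => squarefree_dehomogenize_of_isHomogeneous i hg hsq, fun i => isRadical_span_dehomogenize_of_squarefree i hg hsq⟩
  exact Ideal.le_radical (Ideal.mem_span_singleton.mpr hgφ)

end Field

/-! ## Over `R ⧸ (c)` with `(c)` maximal, lifted to `R`: the data of part 2 -/

section Lift

variable {R : Type u} [CommRing R] {r : ℕ} (c : Fin r → R)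

/-- **T-TCONE's `G`, stalk form (the data `(G, (R1), (R2))` of part 2).** Let `(c) ⊆ R` be a maximal ideal (`R = 𝒪_{F,x}`, `c` a
system of generators of `𝔪_x`, `k = R/(c)` the residue field) and `Φ ∈ R[T]` a form of degree `d` with non-zero reduction
`φ ∈ k[T]` (the initial form). Then there is a FORM `G ∈ R[T]` (of some degree `d'`) with non-zero reduction `ḡ` such that
(R1) `φ ∈ √(ḡ)`, `ḡ ∈ √(φ)`, (R2) every `(ḡ(T_j := 1))` is a radical ideal, and every `ḡ(T_j := 1)` is square-free — the square-free
part of the initial form, lifted (res-type-032's `exists_isHomogeneous_map_eq_of_surjective`). [folklore] -/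
theorem exists_isHomogeneous_squarefree_reduction (hmax : (Ideal.span (Set.range c)).IsMaximal) {d : ℕ}
    (Φ : MvPolynomial (Fin r) R) (hΦd : Φ.IsHomogeneous d)
    (hΦ : MvPolynomial.map (Ideal.Quotient.mk (Ideal.span (Set.range c))) Φ ≠ 0) :
    ∃ (d' : ℕ) (G : MvPolynomial (Fin r) R), G.IsHomogeneous d' ∧
      MvPolynomial.map (Ideal.Quotient.mk (Ideal.span (Set.range c))) G ≠ 0 ∧
      Squarefree (MvPolynomial.map (Ideal.Quotient.mk (Ideal.span (Set.range c))) G) ∧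
      MvPolynomial.map (Ideal.Quotient.mk (Ideal.span (Set.range c))) Φ ∈
        (Ideal.span {MvPolynomial.map (Ideal.Quotient.mk (Ideal.span (Set.range c))) G}).radical ∧
      MvPolynomial.map (Ideal.Quotient.mk (Ideal.span (Set.range c))) G ∈
        (Ideal.span {MvPolynomial.map (Ideal.Quotient.mk (Ideal.span (Set.range c))) Φ}).radical ∧
      (∀ j : Fin r, (Ideal.span {MvPolynomial.map (Ideal.Quotient.mk (Ideal.span (Set.range c)))
        (dehomogenize j G)}).IsRadical) ∧
      ∀ j : Fin r, Squarefree (MvPolynomial.map (Ideal.Quotient.mk (Ideal.span (Set.range c))) (dehomogenize j G)) := by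
  classical
  haveI := hmax
  letI : Field (R ⧸ Ideal.span (Set.range c)) := Ideal.Quotient.field _
  obtain ⟨g, hg, hg0, hsq, hR1, hR1', hsqj, hR2⟩ := exists_squarefree_initialForm (hΦd.map _) hΦ
  obtain ⟨G, hG, hGg⟩ := exists_isHomogeneous_map_eq_of_surjective (Ideal.Quotient.mk (Ideal.span (Set.range c)))
    Ideal.Quotient.mk_surjective g hg
  refine ⟨g.totalDegree, G, hG, ?_, ?_, ?_, ?_, ?_, ?_⟩
  · rw [hGg]; exact hg0
  · rw [hGg]; exact hsq
  · rw [hGg]; exact hR1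
  · rw [hGg]; exact hR1'
  · intro j; rw [map_dehomogenize, hGg]; exact hR2 j
  · intro j; rw [map_dehomogenize, hGg]; exact hsqj j

end Lift

end Summit.ResolutionOfSingularities.ResolutionOfSingularities.Cruxes.EquisingularLiftNat.Sections

end
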